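import Summits.Ventures.PercRepro.RankLevelSetRuleQSliceBand

/-!
# PercRepro — TWO IDENTITIES OF THE SLICE SUMS: SUMMATION BY PARTS AND A CHEBYSHEV INEQUALITY (night-1, gen 22; dossier §34)

For the slice sums `S_j(q, i) = Σ_{a ≤ i} C(i, a)/C(q+j+a, a+j)` (`sliceS`):
* **`sliceS_ibp`** — the summation-by-parts identity `(j+1)·S_j(q, i+1) = (q+i+j+2)·S_{j+1}(q, i+1) − 2(i+1)·S_{j+1}(q, i)`
  (the integral reading: `(d/dt)[t^{j+1}(1−t)^u(1−t²)^i]` against `T ~ Beta(1, q)`; the discrete proof is a telescoping sum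
  with `g(a) = a·C(i+1, a)/C(q+j+a, a+j)`);
* `sum_sum_mul_sub_nonpos` — the rearrangement lemma: for nonnegative weights `V, U` with an increasing likelihood ratio
  (`V b·U a ≤ V a·U b` for `a ≤ b`) and a monotone `y`, `Σ_a Σ_b V a·U b·(y a − y b) ≤ 0`;
* **`sliceS_chebyshev`** — `S_{j+1}(q, i+1)·S_{j+2}(q, i) ≤ S_j(q, i+1)·S_{j+3}(q, i)` (the covariance of `T` and `T²/(1+T)` under
  `t^j(1−t)^{q−1}(1+t)^{i+1}dt` is nonnegative; discretely, the likelihood ratio `C(i, b−2)/C(i+1, b)` is increasing in `b`).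
These are the two ingredients of the variance condition of RankLevelSetRuleQSliceUnimodal. Axioms: standard.
-/

namespace PercRepro

open Finset

/-- The slice sums are positive. -/
lemma sliceS_pos (q m j : ℕ) : 0 < sliceS q m j := by
  unfold sliceS
  apply Finset.sum_pos
  · intro a ha
    rw [Finset.mem_range] at ha
    exact div_pos (Nat.cast_pos.mpr (Nat.choose_pos (by omega))) (Nat.cast_pos.mpr (Nat.choose_pos (by omega)))
  · exact ⟨0, Finset.mem_range.mpr (Nat.succ_pos _)⟩

/-! ### §1 Summation by parts -/

/-- The telescoping term: with `A = C(q+j+a, a+j)`, `B = C(q+j+a+1, a+j+1)`, `P = C(I, a)`, `P' = C(I, a+1)`, `P'' = C(I−1, a)`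
(`I = i + 1`): `(j+1)P/A − (q+I+j+1)P/B + 2I·P''/B = (a+1)P'/B − a·P/A`. -/
lemma ibp_term (q i j a : ℕ) :
    ((j : ℚ) + 1) * (((i + 1).choose a : ℚ) / ((q + j + a).choose (a + j) : ℚ))
      - ((q : ℚ) + (i + 1) + j + 1) * (((i + 1).choose a : ℚ) / ((q + (j + 1) + a).choose (a + (j + 1)) : ℚ))
      + 2 * ((i : ℚ) + 1) * ((i.choose a : ℚ) / ((q + (j + 1) + a).choose (a + (j + 1)) : ℚ))
      = ((a + 1 : ℕ) : ℚ) * ((i + 1).choose (a + 1) : ℚ) / ((q + j + (a + 1)).choose (a + 1 + j) : ℚ)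
        - (a : ℚ) * ((i + 1).choose a : ℚ) / ((q + j + a).choose (a + j) : ℚ) := by
  have hB : (q + (j + 1) + a).choose (a + (j + 1)) = (q + j + (a + 1)).choose (a + 1 + j) := by
    rw [show q + (j + 1) + a = q + j + (a + 1) by ring, show a + (j + 1) = a + 1 + j by ring]
  rw [hB]
  have e1 := Nat.add_one_mul_choose_eq (q + j + a) (a + j)
  rw [show q + j + a + 1 = q + j + (a + 1) by ring, show a + j + 1 = a + 1 + j by ring] at e1
  have hA : (0 : ℚ) < ((q + j + a).choose (a + j) : ℚ) := Nat.cast_pos.mpr (Nat.choose_pos (by omega))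
  have hB' : (0 : ℚ) < ((q + j + (a + 1)).choose (a + 1 + j) : ℚ) := Nat.cast_pos.mpr (Nat.choose_pos (by omega))
  have hBeq : ((q + j + (a + 1)).choose (a + 1 + j) : ℚ)
      = ((q + j + a).choose (a + j) : ℚ) * ((q : ℚ) + j + (a + 1)) / ((a : ℚ) + 1 + j) := by
    have := congrArg (fun x : ℕ => (x : ℚ)) e1
    push_cast at this
    rw [eq_div_iff (by positivity)]
    linarith [this]
  rcases Nat.lt_or_ge a (i + 2) with ha | ha
  · -- a ≤ i + 1: C(i+1, a+1) = P·(i+1−a)/(a+1), C(i, a) = P·(i+1−a)/(i+1)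
    have e2 := Nat.choose_succ_right_eq (i + 1) a
    have e3 := Nat.add_one_mul_choose_eq i a
    have hP' : ((i + 1).choose (a + 1) : ℚ) = ((i + 1).choose a : ℚ) * ((i : ℚ) + 1 - a) / ((a : ℚ) + 1) := by
      have := congrArg (fun x : ℕ => (x : ℚ)) e2
      push_cast [Nat.cast_sub (by omega : a ≤ i + 1)] at this
      rw [eq_div_iff (by positivity)]
      linarith [this]
    have hP'' : (i.choose a : ℚ) = ((i + 1).choose a : ℚ) * ((i : ℚ) + 1 - a) / ((i : ℚ) + 1) := by
      have := congrArg (fun x : ℕ => (x : ℚ)) e3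
      push_cast at this
      rw [eq_div_iff (by positivity)]
      rw [hP'] at this
      field_simp at this
      linarith [this]
    rw [hBeq, hP', hP'']
    push_cast
    field_simp
    ring
  · -- a ≥ i + 2: every binomial in `i` vanishes
    have h0 : (i + 1).choose (a + 1) = 0 := Nat.choose_eq_zero_of_lt (by omega)
    have h0' : i.choose a = 0 := Nat.choose_eq_zero_of_lt (by omega)
    have h0'' : (i + 1).choose a = 0 := Nat.choose_eq_zero_of_lt (by omega)
    rw [h0, h0', h0'']
    simp

/-- **SUMMATION BY PARTS**: `(j+1)·S_j(q, i+1) = (q+i+j+2)·S_{j+1}(q, i+1) − 2(i+1)·S_{j+1}(q, i)`. -/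
theorem sliceS_ibp (q i j : ℕ) :
    ((j : ℚ) + 1) * sliceS q (i + 1) j
      = ((q : ℚ) + (i + 1) + j + 1) * sliceS q (i + 1) (j + 1) - 2 * ((i : ℚ) + 1) * sliceS q i (j + 1) := by
  have hext : sliceS q i (j + 1)
      = ∑ a ∈ range (i + 1 + 1), (i.choose a : ℚ) / ((q + (j + 1) + a).choose (a + (j + 1)) : ℚ) := by
    unfold sliceS
    rw [Finset.sum_range_succ _ (i + 1), Nat.choose_succ_self, Nat.cast_zero, zero_div, add_zero]
  have key : ∑ a ∈ range (i + 1 + 1),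
      (((j : ℚ) + 1) * (((i + 1).choose a : ℚ) / ((q + j + a).choose (a + j) : ℚ))
        - ((q : ℚ) + (i + 1) + j + 1) * (((i + 1).choose a : ℚ) / ((q + (j + 1) + a).choose (a + (j + 1)) : ℚ))
        + 2 * ((i : ℚ) + 1) * ((i.choose a : ℚ) / ((q + (j + 1) + a).choose (a + (j + 1)) : ℚ))) = 0 := by
    rw [Finset.sum_congr rfl (fun a _ => ibp_term q i j a)]
    rw [Finset.sum_range_sub (fun a => (a : ℚ) * ((i + 1).choose a : ℚ) / ((q + j + a).choose (a + j) : ℚ))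
      (i + 1 + 1)]
    simp only [Nat.choose_succ_self, Nat.cast_zero, mul_zero, zero_div, zero_mul, sub_zero]
  rw [hext]
  unfold sliceS
  rw [Finset.sum_add_distrib, Finset.sum_sub_distrib, ← Finset.mul_sum, ← Finset.mul_sum, ← Finset.mul_sum] at key
  linarith [key]

/-! ### §2 The rearrangement lemma and the Chebyshev inequality -/

/-- **The rearrangement lemma**: weights `V, U` with an increasing likelihood ratio and a monotone `y` give
`Σ_a Σ_b V a·U b·(y a − y b) ≤ 0`. -/
lemma sum_sum_mul_sub_nonpos (n : ℕ) (V U y : ℕ → ℚ)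
    (hy : ∀ a b, a ≤ b → y a ≤ y b) (hlr : ∀ a b, a ≤ b → V b * U a ≤ V a * U b) :
    ∑ a ∈ range n, ∑ b ∈ range n, V a * U b * (y a - y b) ≤ 0 := by
  have hswap : ∑ a ∈ range n, ∑ b ∈ range n, V a * U b * (y a - y b)
      = ∑ a ∈ range n, ∑ b ∈ range n, V b * U a * (y b - y a) := Finset.sum_comm
  have h2 : 2 * ∑ a ∈ range n, ∑ b ∈ range n, V a * U b * (y a - y b)
      = ∑ a ∈ range n, ∑ b ∈ range n, (V a * U b - V b * U a) * (y a - y b) := by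
    rw [two_mul]
    nth_rewrite 2 [hswap]
    rw [← Finset.sum_add_distrib]
    refine Finset.sum_congr rfl (fun a _ => ?_)
    rw [← Finset.sum_add_distrib]
    refine Finset.sum_congr rfl (fun b _ => ?_)
    ring
  have h3 : ∑ a ∈ range n, ∑ b ∈ range n, (V a * U b - V b * U a) * (y a - y b) ≤ 0 := by
    apply Finset.sum_nonpos
    intro a _
    apply Finset.sum_nonpos
    intro b _
    rcases le_total a b with hab | hab
    · exact mul_nonpos_of_nonneg_of_nonpos (by linarith [hlr a b hab]) (by linarith [hy a b hab])
    · exact mul_nonpos_of_nonpos_of_nonneg (by linarith [hlr b a hab]) (by linarith [hy b a hab])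
  linarith

/-- The binomial likelihood-ratio inequality: `C(i+1, b+2)·C(i, a) ≤ C(i+1, a+2)·C(i, b)` for `a ≤ b ≤ i`. -/
lemma choose_lr (i a b : ℕ) (hab : a ≤ b) (hbi : b ≤ i) :
    (i + 1).choose (b + 2) * i.choose a ≤ (i + 1).choose (a + 2) * i.choose b := by
  have eb1 := Nat.add_one_mul_choose_eq i b          -- (i+1) C(i,b) = C(i+1,b+1) (b+1)
  have eb2 := Nat.choose_succ_right_eq (i + 1) (b + 1) -- C(i+1,b+2) (b+2) = C(i+1,b+1) (i+1-(b+1))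
  have ea1 := Nat.add_one_mul_choose_eq i a
  have ea2 := Nat.choose_succ_right_eq (i + 1) (a + 1)
  rw [show i + 1 - (b + 1) = i - b by omega] at eb2
  rw [show i + 1 - (a + 1) = i - a by omega] at ea2
  -- (b+2)(b+1) X = (i+1)(i−b) W ; (a+2)(a+1) Z = (i+1)(i−a) Y
  have hb : (b + 2) * (b + 1) * (i + 1).choose (b + 2) = (i + 1) * (i - b) * i.choose b := by
    calc (b + 2) * (b + 1) * (i + 1).choose (b + 2) = (b + 1) * ((i + 1).choose (b + 2) * (b + 2)) := by ring
      _ = (b + 1) * ((i + 1).choose (b + 1) * (i - b)) := by rw [eb2]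
      _ = (i - b) * ((i + 1).choose (b + 1) * (b + 1)) := by ring
      _ = (i - b) * ((i + 1) * i.choose b) := by rw [eb1]
      _ = (i + 1) * (i - b) * i.choose b := by ring
  have ha : (a + 2) * (a + 1) * (i + 1).choose (a + 2) = (i + 1) * (i - a) * i.choose a := by
    calc (a + 2) * (a + 1) * (i + 1).choose (a + 2) = (a + 1) * ((i + 1).choose (a + 2) * (a + 2)) := by ring
      _ = (a + 1) * ((i + 1).choose (a + 1) * (i - a)) := by rw [ea2]
      _ = (i - a) * ((i + 1).choose (a + 1) * (a + 1)) := by ring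
      _ = (i - a) * ((i + 1) * i.choose a) := by rw [ea1]
      _ = (i + 1) * (i - a) * i.choose a := by ring
  have hK : 0 < (b + 2) * (b + 1) * ((a + 2) * (a + 1)) := by positivity
  apply Nat.le_of_mul_le_mul_left _ hK
  have hcmp : (i - b) * ((a + 2) * (a + 1)) ≤ (i - a) * ((b + 2) * (b + 1)) :=
    Nat.mul_le_mul (Nat.sub_le_sub_left hab i) (by nlinarith)
  calc (b + 2) * (b + 1) * ((a + 2) * (a + 1)) * ((i + 1).choose (b + 2) * i.choose a)
      = ((b + 2) * (b + 1) * (i + 1).choose (b + 2)) * ((a + 2) * (a + 1)) * i.choose a := by ring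
    _ = (i + 1) * (i - b) * i.choose b * ((a + 2) * (a + 1)) * i.choose a := by rw [hb]
    _ = ((i + 1) * i.choose b * i.choose a) * ((i - b) * ((a + 2) * (a + 1))) := by ring
    _ ≤ ((i + 1) * i.choose b * i.choose a) * ((i - a) * ((b + 2) * (b + 1))) := Nat.mul_le_mul_left _ hcmp
    _ = (i + 1) * (i - a) * i.choose a * ((b + 2) * (b + 1)) * i.choose b := by ring
    _ = ((a + 2) * (a + 1) * (i + 1).choose (a + 2)) * ((b + 2) * (b + 1)) * i.choose b := by rw [ha]
    _ = (b + 2) * (b + 1) * ((a + 2) * (a + 1)) * ((i + 1).choose (a + 2) * i.choose b) := by ring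

/-- The ratio `x_n = C(q+n, n)/C(q+n+1, n+1) = (n+1)/(q+n+1)` is increasing in `n`. -/
lemma choose_ratio_mono (q n n' : ℕ) (h : n ≤ n') :
    ((q + n).choose n : ℚ) / ((q + n + 1).choose (n + 1) : ℚ)
      ≤ ((q + n').choose n' : ℚ) / ((q + n' + 1).choose (n' + 1) : ℚ) := by
  have e1 := Nat.add_one_mul_choose_eq (q + n) n
  have e2 := Nat.add_one_mul_choose_eq (q + n') n'
  have hA : (0 : ℚ) < ((q + n + 1).choose (n + 1) : ℚ) := Nat.cast_pos.mpr (Nat.choose_pos (by omega))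
  have hB : (0 : ℚ) < ((q + n' + 1).choose (n' + 1) : ℚ) := Nat.cast_pos.mpr (Nat.choose_pos (by omega))
  have c1 : ((q + n).choose n : ℚ) = ((q + n + 1).choose (n + 1) : ℚ) * ((n : ℚ) + 1) / ((q : ℚ) + n + 1) := by
    have := congrArg (fun x : ℕ => (x : ℚ)) e1
    push_cast at this
    rw [eq_div_iff (by positivity)]
    linarith [this]
  have c2 : ((q + n').choose n' : ℚ) = ((q + n' + 1).choose (n' + 1) : ℚ) * ((n' : ℚ) + 1) / ((q : ℚ) + n' + 1) := by
    have := congrArg (fun x : ℕ => (x : ℚ)) e2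
    push_cast at this
    rw [eq_div_iff (by positivity)]
    linarith [this]
  rw [c1, c2]
  have hn : (n : ℚ) ≤ n' := by exact_mod_cast h
  rw [show ((q + n + 1).choose (n + 1) : ℚ) * ((n : ℚ) + 1) / ((q : ℚ) + n + 1) / ((q + n + 1).choose (n + 1) : ℚ)
      = ((n : ℚ) + 1) / ((q : ℚ) + n + 1) by field_simp,
    show ((q + n' + 1).choose (n' + 1) : ℚ) * ((n' : ℚ) + 1) / ((q : ℚ) + n' + 1) / ((q + n' + 1).choose (n' + 1) : ℚ)
      = ((n' : ℚ) + 1) / ((q : ℚ) + n' + 1) by field_simp,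
    div_le_div_iff₀ (by positivity) (by positivity)]
  nlinarith

/-- **THE CHEBYSHEV INEQUALITY OF THE SLICE SUMS**: `S_{j+1}(q, i+1)·S_{j+2}(q, i) ≤ S_j(q, i+1)·S_{j+3}(q, i)`. -/
theorem sliceS_chebyshev (q i j : ℕ) :
    sliceS q (i + 1) (j + 1) * sliceS q i (j + 2) ≤ sliceS q (i + 1) j * sliceS q i (j + 3) := by
  -- c n = 1/C(q+n, n); x n = c(n+1)/c n; V a = C(i+1, a) c(j+a); U b = C(i, b−2) c(j+b) (b ≥ 2); y n = x(j+n)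
  have hcpos : ∀ n : ℕ, (0 : ℚ) < 1 / ((q + n).choose n : ℚ) := fun n =>
    div_pos one_pos (Nat.cast_pos.mpr (Nat.choose_pos (by omega)))
  have hcx : ∀ n : ℕ, (1 : ℚ) / ((q + (n + 1)).choose (n + 1) : ℚ)
      = 1 / ((q + n).choose n : ℚ) * (((q + n).choose n : ℚ) / ((q + n + 1).choose (n + 1) : ℚ)) := fun n => by
    have h1 : (0 : ℚ) < ((q + n).choose n : ℚ) := Nat.cast_pos.mpr (Nat.choose_pos (by omega))
    have h2 : (0 : ℚ) < ((q + n + 1).choose (n + 1) : ℚ) := Nat.cast_pos.mpr (Nat.choose_pos (by omega))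
    rw [show q + (n + 1) = q + n + 1 by ring]
    field_simp
  -- the four slice sums in the `c` spelling
  have e1 : sliceS q (i + 1) (j + 1) = ∑ a ∈ range (i + 2), ((i + 1).choose a : ℚ) * (1 / ((q + (j + 1 + a)).choose (j + 1 + a) : ℚ)) := by
    unfold sliceS
    refine Finset.sum_congr rfl (fun a _ => ?_)
    rw [show q + (j + 1) + a = q + (j + 1 + a) by ring, show a + (j + 1) = j + 1 + a by ring, div_eq_mul_one_div]
  have e2 : sliceS q i (j + 2) = ∑ b ∈ range (i + 1), (i.choose b : ℚ) * (1 / ((q + (j + 2 + b)).choose (j + 2 + b) : ℚ)) := by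
    unfold sliceS
    refine Finset.sum_congr rfl (fun b _ => ?_)
    rw [show q + (j + 2) + b = q + (j + 2 + b) by ring, show b + (j + 2) = j + 2 + b by ring, div_eq_mul_one_div]
  have e3 : sliceS q (i + 1) j = ∑ a ∈ range (i + 2), ((i + 1).choose a : ℚ) * (1 / ((q + (j + a)).choose (j + a) : ℚ)) := by
    unfold sliceS
    refine Finset.sum_congr rfl (fun a _ => ?_)
    rw [show a + j = j + a by ring, show q + j + a = q + (j + a) by ring, div_eq_mul_one_div]
  have e4 : sliceS q i (j + 3) = ∑ b ∈ range (i + 1), (i.choose b : ℚ) * (1 / ((q + (j + 3 + b)).choose (j + 3 + b) : ℚ)) := by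
    unfold sliceS
    refine Finset.sum_congr rfl (fun b _ => ?_)
    rw [show q + (j + 3) + b = q + (j + 3 + b) by ring, show b + (j + 3) = j + 3 + b by ring, div_eq_mul_one_div]
  rw [e1, e2, e3, e4, Finset.sum_mul_sum, Finset.sum_mul_sum, ← sub_nonpos, ← Finset.sum_sub_distrib]
  simp only [← Finset.sum_sub_distrib]
  -- termwise: C(i+1,a) C(i,b) [c(j+1+a) c(j+2+b) − c(j+a) c(j+3+b)] = V a * U₀ b * (y a − y (b+2))
  have hterm : ∀ a ∈ range (i + 2), ∀ b ∈ range (i + 1),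
      ((i + 1).choose a : ℚ) * (1 / ((q + (j + 1 + a)).choose (j + 1 + a) : ℚ))
          * ((i.choose b : ℚ) * (1 / ((q + (j + 2 + b)).choose (j + 2 + b) : ℚ)))
        - ((i + 1).choose a : ℚ) * (1 / ((q + (j + a)).choose (j + a) : ℚ))
          * ((i.choose b : ℚ) * (1 / ((q + (j + 3 + b)).choose (j + 3 + b) : ℚ)))
      = (((i + 1).choose a : ℚ) * (1 / ((q + (j + a)).choose (j + a) : ℚ)))
          * ((i.choose b : ℚ) * (1 / ((q + (j + 2 + b)).choose (j + 2 + b) : ℚ)))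
          * (((q + (j + a)).choose (j + a) : ℚ) / ((q + (j + a) + 1).choose (j + a + 1) : ℚ)
            - ((q + (j + (b + 2))).choose (j + (b + 2)) : ℚ) / ((q + (j + (b + 2)) + 1).choose (j + (b + 2) + 1) : ℚ)) := by
    intro a _ b _
    rw [show j + 1 + a = j + a + 1 by ring, hcx (j + a), show j + 3 + b = j + 2 + b + 1 by ring, hcx (j + 2 + b),
      show j + (b + 2) = j + 2 + b by ring]
    ring
  rw [Finset.sum_congr rfl (fun a ha => Finset.sum_congr rfl (fun b hb => hterm a ha b hb))]
  -- the rearrangement on range (i+3) × range (i+3)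
  set V : ℕ → ℚ := fun a => ((i + 1).choose a : ℚ) * (1 / ((q + (j + a)).choose (j + a) : ℚ)) with hV
  set U : ℕ → ℚ := fun b => if 2 ≤ b then (i.choose (b - 2) : ℚ) * (1 / ((q + (j + b)).choose (j + b) : ℚ)) else 0 with hU
  set y : ℕ → ℚ := fun n => ((q + (j + n)).choose (j + n) : ℚ) / ((q + (j + n) + 1).choose (j + n + 1) : ℚ) with hy
  have hU2 : ∀ b, U (b + 2) = (i.choose b : ℚ) * (1 / ((q + (j + 2 + b)).choose (j + 2 + b) : ℚ)) := fun b => by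
    simp only [hU, show 2 ≤ b + 2 by omega, if_true, show b + 2 - 2 = b by omega, show j + (b + 2) = j + 2 + b by ring]
  have hU0 : U 0 = 0 := by simp only [hU]; norm_num
  have hU1 : U 1 = 0 := by simp only [hU]; norm_num
  have hinner : ∀ a, ∑ b ∈ range (i + 1),
      V a * ((i.choose b : ℚ) * (1 / ((q + (j + 2 + b)).choose (j + 2 + b) : ℚ))) * (y a - y (b + 2))
      = ∑ b ∈ range (i + 3), V a * U b * (y a - y b) := fun a => by
    rw [Finset.sum_range_succ' _ (i + 2), Finset.sum_range_succ' _ (i + 1)]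
    simp only [zero_add, hU0, hU1, mul_zero, zero_mul, add_zero]
    refine Finset.sum_congr rfl (fun b _ => ?_)
    rw [show b + 1 + 1 = b + 2 by ring, hU2 b]
  have houter : ∑ a ∈ range (i + 2), ∑ b ∈ range (i + 1),
      V a * ((i.choose b : ℚ) * (1 / ((q + (j + 2 + b)).choose (j + 2 + b) : ℚ))) * (y a - y (b + 2))
      = ∑ a ∈ range (i + 3), ∑ b ∈ range (i + 3), V a * U b * (y a - y b) := by
    rw [Finset.sum_range_succ _ (i + 2)]
    have hV0 : V (i + 2) = 0 := by
      simp only [hV, Nat.choose_eq_zero_of_lt (show i + 1 < i + 2 by omega), Nat.cast_zero, zero_mul]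
    simp only [hV0, zero_mul, Finset.sum_const_zero, add_zero]
    exact Finset.sum_congr rfl (fun a _ => hinner a)
  change ∑ a ∈ range (i + 2), ∑ b ∈ range (i + 1),
      V a * ((i.choose b : ℚ) * (1 / ((q + (j + 2 + b)).choose (j + 2 + b) : ℚ))) * (y a - y (b + 2)) ≤ 0
  rw [houter]
  apply sum_sum_mul_sub_nonpos (i + 3) V U y
  · intro a b hab
    simp only [hy]
    rw [show q + (j + a) + 1 = q + (j + a) + 1 from rfl]
    exact choose_ratio_mono q (j + a) (j + b) (by omega)
  · intro a b hab
    have hVnn : ∀ n, 0 ≤ V n := fun n => by simp only [hV]; positivity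
    have hUnn : ∀ n, 0 ≤ U n := fun n => by
      simp only [hU]; split_ifs <;> positivity
    rcases Nat.lt_or_ge a 2 with ha2 | ha2
    · have : U a = 0 := by simp only [hU, show ¬ (2 ≤ a) by omega, if_false]
      rw [this, mul_zero]
      exact mul_nonneg (hVnn a) (hUnn b)
    · rcases Nat.lt_or_ge b (i + 2) with hb | hb
      · -- 2 ≤ a ≤ b ≤ i + 1
        obtain ⟨a', rfl⟩ : ∃ a', a = a' + 2 := ⟨a - 2, by omega⟩
        obtain ⟨b', rfl⟩ : ∃ b', b = b' + 2 := ⟨b - 2, by omega⟩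
        simp only [hV, hU, show 2 ≤ a' + 2 by omega, show 2 ≤ b' + 2 by omega, if_true,
          show a' + 2 - 2 = a' by omega, show b' + 2 - 2 = b' by omega]
        have hlr := choose_lr i a' b' (by omega) (by omega)
        have hlrq : ((i + 1).choose (b' + 2) : ℚ) * (i.choose a' : ℚ) ≤ ((i + 1).choose (a' + 2) : ℚ) * (i.choose b' : ℚ) := by
          exact_mod_cast hlr
        have hc1 := hcpos (j + (a' + 2))
        have hc2 := hcpos (j + (b' + 2))
        calc ((i + 1).choose (b' + 2) : ℚ) * (1 / ((q + (j + (b' + 2))).choose (j + (b' + 2)) : ℚ))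
              * ((i.choose a' : ℚ) * (1 / ((q + (j + (a' + 2))).choose (j + (a' + 2)) : ℚ)))
            = (((i + 1).choose (b' + 2) : ℚ) * (i.choose a' : ℚ))
              * ((1 / ((q + (j + (b' + 2))).choose (j + (b' + 2)) : ℚ)) * (1 / ((q + (j + (a' + 2))).choose (j + (a' + 2)) : ℚ))) := by ring
          _ ≤ (((i + 1).choose (a' + 2) : ℚ) * (i.choose b' : ℚ))
              * ((1 / ((q + (j + (b' + 2))).choose (j + (b' + 2)) : ℚ)) * (1 / ((q + (j + (a' + 2))).choose (j + (a' + 2)) : ℚ))) :=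
              mul_le_mul_of_nonneg_right hlrq (by positivity)
          _ = _ := by ring
      · have : V b = 0 := by
          simp only [hV, Nat.choose_eq_zero_of_lt (show i + 1 < b by omega), Nat.cast_zero, zero_mul]
        rw [this, zero_mul]
        exact mul_nonneg (hVnn a) (hUnn b)

end PercRepro
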